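import Literature.AlgebraicGeometry.GroupSchemes.FrobeniusKillsImage
import Literature.AlgebraicGeometry.GroupSchemes.FrobeniusKernelIdealStable
import Literature.AlgebraicGeometry.GroupSchemes.HopfIdealOfFiniteSubgroupOfPoints
import Literature.AlgebraicGeometry.GroupSchemes.CanonicalSubgroupOfPoints
import Literature.AlgebraicGeometry.GroupSchemes.HopfIdealOfClosedSubgroup
import Literature.AlgebraicGeometry.GroupSchemes.EtaleOfTrivialUnitComponent
import Literature.AlgebraicGeometry.GroupSchemes.ConnectedFactorsThroughUnitComponent
import Literature.AlgebraicGeometry.GroupSchemes.AffineGroupSchemeBialgHom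
import Mathlib.AlgebraicGeometry.Morphisms.Etale
import HarnessLib

/-!
# Frobenius kills the quotient by the Frobenius kernel of a SUPERSINGULAR block (the (c3c) assembly `stub_K3c`)

Topic `Literature/AlgebraicGeometry/GroupSchemes`; namespace `Literature.AlgebraicGeometry.GroupSchemes.FrobKillSS`.  THEOREMS ONLY (no definition,
no instance, no notation, no named fact, no `sorry`).  Cell `hodgecm-mathlib` (D-0151), P6 «MOD programme» (crux hLiu418 = stmt-HodgeConjecture-24832,
`--supports`), DICT constructor desk F0P6c-plan (g2) deal D3-ss (2026-09-01): the CLOSER of the registered stub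
`stub_K3c_comp_relFrobeniusOver_eq_one_of_forall_not_isEtale` of `Cruxes/HLiu418/Lines/F0_P6c_DictConstructors.lean`, stated here with the line's
three carrier definitions UNFOLDED (`kerFI p f G = ker Γ(ι_{Ker F})`, `IsAdm G β r I = IsHopfIdeal ∧ finrank (Γ(G)⧸I) = r ∧ ∀ a, I.map Γ(β a) ≤ I`,
`IdealIsEtale G I = Etale (Spec (Γ(G)⧸I) → Spec k)`), so that the line's ED. 2 discharges the stub by one `exact`.  HC_CM is proved only modulo the
printed citations until rung 0 closes; this file is generic finite-group-scheme algebra and changes no count.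

THE MATHEMATICS ([Tate1997FiniteFlatGroupSchemes] (3.7), [SGA3I] VII_A 4.1).  `k` algebraically closed of characteristic `p`, `q = p^f`, `G` a FINITE
commutative `k`-group scheme (the `𝔴`-torsion `𝒜_x̄[𝔴]` of the `w`-block at a special point, rank `q²`) with unit component `j_U : U ↪ G` killed by
the square of the `q`-Frobenius (`j_U ≫ F_G ≫ F_{G^{(q)}} = 1`, ★ (FK) `InfinitesimalKilledByFrobeniusPower` + ★ B-p17's iterate bridge), whose
group of `k`-points has order `1` or `q` (`hpts`), and such that NO admissible ideal of rank `q` is étale (`hnone`: the point is SUPERSINGULAR).  Let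
`φ : G → G′` be a homomorphism killing the Frobenius kernel `V(ker Γ(ι_{Ker F_G})) = Ker F_G`.  Then `φ ≫ F_{G′} = 1`:
* (§2) if `#G(k) = q` the ideal of ALL `k`-points is a Hopf ideal (★ `isHopfIdeal_ker_pi`; the evaluation map `Γ(G) → k^{G(k)}` is onto by the
  Chinese remainder theorem, distinct points of an algebra over a FIELD having distinct kernels), of rank `q` (★ `finrank_quotient_ker_pi_ptEquiv`),
  stable under EVERY endomorphism (pull-back permutes points) and ÉTALE (★ `etale_specOver_quotient_ker_hom`) — contradicting `hnone`; so
* (§3) `#G(k) = 1`, `G` is connected (★ μ3 `connectedSpace_left_of_natCard_hom_eq_one`), the identity factors through the unit component (★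
  `existsUnique_fac_hom`), hence `F_G ≫ F_{G^{(q)}} = 1` on all of `G`, and ★ (K-c3) `FrobKill.comp_relFrobeniusOver_eq_one_of_kerι_comp_eq_one`
  (B-p17) concludes, the hypothesis «`φ` kills `Ker F_G`» being moved from the ideal `V(ker Γ(ι))` to `ι_{Ker F}` by ★
  `exists_iso_comp_quotIncl_ker_appTop_eq` (instances ★ `FrobKerIdeal.isClosedImmersion_kerι_relFrobeniusOver_left` ∕ `isAffine_ker_relFrobeniusOver_left`, A-p14).

* §1 `algHom_eq_of_ker_eq` (private), **`surjective_pi_ptEquiv_of_injective`** (CRT for distinct `k`-points over a field).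
* §2 **`exists_admissible_etale_ideal_of_natCard_eq`** (the points ideal when `#G(k) = r`).
* §3 `kerι_comp_eq_one_of_quotIncl_ker_appTop_comp_eq_one`, `comp_relFrobeniusOver_eq_one_of_natCard_eq_one`,
  **`comp_relFrobeniusOver_eq_one_of_forall_not_isEtale`** (= `stub_K3c` unfolded).

## References
* [Tate1997FiniteFlatGroupSchemes] J. Tate, *Finite flat group schemes*, in: Modular Forms and Fermat's Last Theorem (1997), (3.7).
* [SGA3I] M. Demazure, A. Grothendieck, *SGA 3, Tome I*, Exp. VII_A §4.1 (Frobenius, its kernel).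
* [GortzWedhorn2020] U. Görtz, T. Wedhorn, *Algebraic Geometry I* (2nd ed.), Definition 4.45 (2), Section (4.7).
* [StacksProject] The Stacks Project, Tags 00DT (Chinese remainder), 04GG.
-/

set_option autoImplicit false

universe u

open CategoryTheory CategoryTheory.Limits AlgebraicGeometry MonoidalCategory CartesianMonoidalCategory
open scoped MonObj Obj

namespace Literature.AlgebraicGeometry.GroupSchemes.FrobKillSS

open Literature.AlgebraicGeometry.Motives (SchemeOver relFrobeniusOver frobeniusTwistOver)
open Literature.AlgebraicGeometry.GroupSchemes.AffineGroupScheme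
open Literature.AlgebraicGeometry.GroupSchemes.GroupSchemeKernel (ker kerι)

/-! ## §1 Over a field, evaluation at finitely many distinct `k`-points is surjective -/

section Points

variable {k : Type u} [Field k]

/-- Two `k`-algebra homomorphisms to the base field with the same kernel are equal (`a − φ(a)·1 ∈ ker φ`). [folklore] -/
private theorem algHom_eq_of_ker_eq {A : Type u} [CommRing A] [Algebra k A] {φ ψ : A →ₐ[k] k}
    (h : RingHom.ker φ.toRingHom = RingHom.ker ψ.toRingHom) : φ = ψ := by
  refine AlgHom.ext fun a => ?_
  have ha : a - algebraMap k A (φ a) ∈ RingHom.ker ψ.toRingHom := by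
    rw [← h, RingHom.mem_ker, AlgHom.toRingHom_eq_coe, AlgHom.coe_toRingHom, map_sub, AlgHom.commutes, Algebra.algebraMap_self,
      RingHom.id_apply, sub_self]
  rw [RingHom.mem_ker, AlgHom.toRingHom_eq_coe, AlgHom.coe_toRingHom, map_sub, AlgHom.commutes, Algebra.algebraMap_self, RingHom.id_apply,
    sub_eq_zero] at ha
  exact ha.symm

variable (G : SchemeOver k) [IsAffine G.left] {J : Type u} (u : J → (Literature.AlgebraicGeometry.Motives.specOver k k ⟶ G))

/-- **Evaluation at finitely many DISTINCT `k`-points of an affine `k`-scheme is SURJECTIVE** `Γ(G) ↠ k^J` (Chinese remainder theorem: over a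
field two points with the same kernel coincide, ★ `ptEquiv` injective; ★ `surjective_pi_of_pairwise_comap_maximalIdeal_ne`).
[cite: StacksProject, Tag 00DT] [cite: Tate1997FiniteFlatGroupSchemes, (3.7)] -/
theorem surjective_pi_ptEquiv_of_injective [Finite J] (hu : Function.Injective u) :
    Function.Surjective (AlgHom.pi fun i => ptEquiv G k (u i) : Alg G →ₐ[k] (J → k)) := by
  have h𝔪 : IsLocalRing.maximalIdeal k = ⊥ := IsLocalRing.isField_iff_maximalIdeal_eq.mp (Field.toIsField k)
  refine Literature.RingTheory.Ideal.surjective_pi_of_pairwise_comap_maximalIdeal_ne _ fun i j hij h => hij (hu ?_)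
  rw [h𝔪, ← RingHom.ker_eq_comap_bot, ← RingHom.ker_eq_comap_bot] at h
  exact (ptEquiv G k).injective (algHom_eq_of_ker_eq h)

end Points

/-! ## §2 When `#G(k) = r`, the ideal of all `k`-points is admissible of rank `r` and étale -/

section PointsIdeal

variable {k : Type u} [Field k] [IsAlgClosed k] (G : SchemeOver k) [GrpObj G] [IsAffine G.left] [IsFinite G.hom]

omit [IsAlgClosed k] in
/-- **THE POINTS IDEAL.**  If the finite `k`-group scheme `G` (`k` algebraically closed) has exactly `r ≠ 0` points, the ideal `I` of all its
`k`-points is a HOPF ideal (★ `isHopfIdeal_ker_pi`), of rank `finrank (Γ(G) ⧸ I) = r` (★ `finrank_quotient_ker_pi_ptEquiv`), stable under every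
endomorphism `β a` of `G` (pull-back along `β a` permutes `k`-points), and `Spec (Γ(G) ⧸ I) → Spec k` is ÉTALE (★ `etale_specOver_quotient_ker_hom`:
`Γ(G) ⧸ I ≅ k^r`).  In the DICT's words: an ÉTALE ADMISSIBLE ideal exists as soon as `#G(k) = q`. [cite: Tate1997FiniteFlatGroupSchemes, (3.7)]
[cite: StacksProject, Tag 04GG] -/
theorem exists_admissible_etale_ideal_of_natCard_eq {σ : Type*} (β : σ → (G ⟶ G)) {r : ℕ} (hr : r ≠ 0)
    (hpts : Nat.card (𝟙_ (SchemeOver k) ⟶ G) = r) :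
    ∃ I : Ideal (Alg G), (I.IsHopfIdeal k ∧ Module.finrank k (Alg G ⧸ I) = r ∧ ∀ a : σ, I.map (β a).left.appTop.hom ≤ I) ∧
      Etale (Literature.AlgebraicGeometry.Motives.specOver k (Alg G ⧸ I)).hom := by
  haveI : Finite (𝟙_ (SchemeOver k) ⟶ G) := Nat.finite_of_card_ne_zero (hpts ▸ hr)
  -- the family of ALL points, read as `Spec k`-points
  let u : (𝟙_ (SchemeOver k) ⟶ G) → (Literature.AlgebraicGeometry.Motives.specOver k k ⟶ G) := fun s => (unitIsoSpecOver (R := k)).inv ≫ s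
  have hu : Function.Injective u := fun s t h => by simpa [u, cancel_epi] using h
  set π : Alg G →ₐ[k] ((𝟙_ (SchemeOver k) ⟶ G) → k) := AlgHom.pi fun s => ptEquiv G k (u s) with hπdef
  have hπ : Function.Surjective π := surjective_pi_ptEquiv_of_injective G u hu
  refine ⟨RingHom.ker π.toRingHom, ⟨?_, ?_, fun a => ?_⟩, ?_⟩
  · -- Hopf: the points form a group
    refine isHopfIdeal_ker_pi G u hπ ⟨1, MonObj.comp_one _⟩ (fun s t => ⟨s * t, MonObj.comp_mul _ _ _⟩) fun s => ⟨s⁻¹, GrpObj.comp_inv _ _⟩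
  · -- rank = number of points
    rw [finrank_quotient_ker_pi_ptEquiv G u hu, hpts]
  · -- stability under the endomorphism `β a`: pull-back permutes points
    rw [Ideal.map_le_iff_le_comap]
    intro x hx
    rw [Ideal.mem_comap]
    refine (mem_ker_pi_ptEquiv_iff G u _).2 fun s => ?_
    have h := (mem_ker_pi_ptEquiv_iff G u x).1 hx (s ≫ β a)
    have hcomp : u (s ≫ β a) = u s ≫ β a := (Category.assoc _ _ _).symm
    rw [hcomp, ptEquiv_comp] at h
    exact h
  · -- étale: `Γ(G) ⧸ I ≅ k^r`
    exact etale_specOver_quotient_ker_hom π hπ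

end PointsIdeal

/-! ## §3 The supersingular FROB-KILL: `φ` killing `Ker F_G` is killed by `F_{G′}` -/

section Supersingular

variable {k : Type u} [Field k] [IsAlgClosed k] (p f : ℕ) [Fact p.Prime] [ExpChar k p]

omit [IsAlgClosed k] [Fact p.Prime] in
set_option synthInstance.maxHeartbeats 400000 in
/-- **From the ideal to the kernel object**: if `φ` kills the closed subscheme `V(ker Γ(ι_{Ker F})) ↪ G` (★ `quotIncl`), it kills `ι_{Ker F}`
(★ `exists_iso_comp_quotIncl_ker_appTop_eq`: `Ker F ≅ V(ker Γ(ι_{Ker F}))` over `G`). [cite: GortzWedhorn2020, Definition 4.45 (2)] -/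
theorem kerι_comp_eq_one_of_quotIncl_ker_appTop_comp_eq_one {G G' : SchemeOver k} [GrpObj G] [IsAffine G.left] [IsFinite G.hom]
    [GrpObj G'] (φ : G ⟶ G')
    (hφ : quotIncl G (RingHom.ker (kerι (relFrobeniusOver p f G)).left.appTop.hom : Ideal (Alg G)) ≫ φ = 1) :
    kerι (relFrobeniusOver p f G) ≫ φ = 1 := by
  haveI := FrobKerIdeal.isClosedImmersion_kerι_relFrobeniusOver_left p f G
  haveI := FrobKerIdeal.isAffine_ker_relFrobeniusOver_left p f G
  obtain ⟨e, he⟩ := exists_iso_comp_quotIncl_ker_appTop_eq (kerι (relFrobeniusOver p f G))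
  rw [← he, Category.assoc, hφ, MonObj.comp_one]

omit [Fact p.Prime] in
set_option synthInstance.maxHeartbeats 400000 in
/-- **Connected case**: if `G` has ONE `k`-point then `G` is connected, the unit component is everything, `F_G ≫ F_{G^{(q)}} = 1` on `G`, and a
homomorphism killing `Ker F_G` is killed by `F_{G′}` (★ (K-c3) `FrobKill.comp_relFrobeniusOver_eq_one_of_kerι_comp_eq_one`).
[cite: SGA3I, VII_A 4.1] [cite: Tate1997FiniteFlatGroupSchemes, (3.7)] -/
theorem comp_relFrobeniusOver_eq_one_of_natCard_eq_one (G G' : SchemeOver k) [GrpObj G] [IsAffine G.left] [IsFinite G.hom] [GrpObj G']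
    (U : SchemeOver k) [GrpObj U] (jU : U ⟶ G)
    (hU : IsMonHom jU ∧ IsOpenImmersion jU.left ∧ IsClosedImmersion jU.left ∧ ConnectedSpace ↥U.left)
    (hFFU : jU ≫ relFrobeniusOver p f G ≫ relFrobeniusOver p f (frobeniusTwistOver p f G) = 1)
    (h1 : Nat.card (𝟙_ (SchemeOver k) ⟶ G) = 1)
    (φ : G ⟶ G') (hφ : quotIncl G (RingHom.ker (kerι (relFrobeniusOver p f G)).left.appTop.hom : Ideal (Alg G)) ≫ φ = 1) :
    φ ≫ relFrobeniusOver p f G' = 1 := by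
  obtain ⟨hjm, hjo, hjc, _⟩ := hU
  haveI := hjm
  haveI := hjo
  haveI := hjc
  haveI : ConnectedSpace ↥G.left := connectedSpace_left_of_natCard_hom_eq_one k G inferInstance h1
  haveI : Nonempty ↥(𝟙_ (SchemeOver k)).left := ⟨(IsLocalRing.closedPoint k : ↥(Spec (CommRingCat.of k)))⟩
  -- the identity of the connected `G` factors through the unit component
  obtain ⟨g, hg⟩ := (existsUnique_fac_hom jU (𝟙 G)).exists
  have hF : relFrobeniusOver p f G ≫ relFrobeniusOver p f (frobeniusTwistOver p f G) = 1 := by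
    calc relFrobeniusOver p f G ≫ relFrobeniusOver p f (frobeniusTwistOver p f G)
        = (g ≫ jU) ≫ relFrobeniusOver p f G ≫ relFrobeniusOver p f (frobeniusTwistOver p f G) := by rw [hg, Category.id_comp]
      _ = 1 := by rw [Category.assoc, hFFU, MonObj.comp_one]
  exact FrobKill.comp_relFrobeniusOver_eq_one_of_kerι_comp_eq_one p f φ hF
    (kerι_comp_eq_one_of_quotIncl_ker_appTop_comp_eq_one p f φ hφ)

set_option synthInstance.maxHeartbeats 400000 in
/-- **`stub_K3c` — FROB-KILL AT A SUPERSINGULAR POINT** (the registered stub of `Lines/F0_P6c_DictConstructors.lean` with `kerFI`, `IsAdm`,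
`IdealIsEtale` unfolded).  `G` a finite commutative `k`-group scheme with unit component `j_U` killed by `F²` (`hFFU`), `#G(k) ∈ {1, q}` (`hpts`),
and NO étale admissible ideal of rank `q` (`hnone`); then every homomorphism `φ : G → G′` killing `V(ker Γ(ι_{Ker F_G}))` satisfies
`φ ≫ F_{G′} = 1`.  Proof: `#G(k) = q` would produce the étale admissible points ideal (§2), so `#G(k) = 1` and §3 applies.  DICT use: (c3c)
`Fr (Fr x̄) = ⟨ϖ⟩ x̄` at supersingular `x̄`. [cite: Tate1997FiniteFlatGroupSchemes, (3.7)] [cite: SGA3I, VII_A 4.1] [cite: GortzWedhorn2020, Definition 4.45 (2)] -/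
theorem comp_relFrobeniusOver_eq_one_of_forall_not_isEtale (G G' : SchemeOver k) [GrpObj G] [IsCommMonObj G]
    [IsAffine G.left] [IsFinite G.hom] [GrpObj G'] [IsAffine G'.left]
    {σ : Type*} (β : σ → (G ⟶ G))
    (U : SchemeOver k) [GrpObj U] [IsAffine U.left] (jU : U ⟶ G)
    (hU : IsMonHom jU ∧ IsOpenImmersion jU.left ∧ IsClosedImmersion jU.left ∧ ConnectedSpace ↥U.left)
    (hFFU : jU ≫ relFrobeniusOver p f G ≫ relFrobeniusOver p f (frobeniusTwistOver p f G) = 1)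
    (hpts : Nat.card (𝟙_ (SchemeOver k) ⟶ G) = 1 ∨ Nat.card (𝟙_ (SchemeOver k) ⟶ G) = p ^ f)
    (hnone : ∀ I : Ideal (Alg G),
      (I.IsHopfIdeal k ∧ Module.finrank k (Alg G ⧸ I) = p ^ f ∧ ∀ a : σ, I.map (β a).left.appTop.hom ≤ I) →
        ¬ Etale (Literature.AlgebraicGeometry.Motives.specOver k (Alg G ⧸ I)).hom)
    (φ : G ⟶ G') [IsMonHom φ]
    (hφ : quotIncl G (RingHom.ker (kerι (relFrobeniusOver p f G)).left.appTop.hom : Ideal (Alg G)) ≫ φ = 1) :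
    φ ≫ relFrobeniusOver p f G' = 1 := by
  rcases hpts with h1 | hq
  · exact comp_relFrobeniusOver_eq_one_of_natCard_eq_one p f G G' U jU hU hFFU h1 φ hφ
  · exfalso
    obtain ⟨I, hI, hIet⟩ := exists_admissible_etale_ideal_of_natCard_eq G β (pow_ne_zero f (Fact.out : p.Prime).ne_zero) hq
    exact hnone I hI hIet

end Supersingular

end Literature.AlgebraicGeometry.GroupSchemes.FrobKillSS
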